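import Literature.MathematicalPhysics.QuantumFieldTheory.Balaban1983to89.B9CoReadingCoordsInputS

/-!
# `Balaban1983to89.B9CoReadingCoordsInputSLoc` — [Balaban1985BackgroundPropagators] (3.39)–(3.41), (3.44) pp. 397–398; [Balaban1984PropagatorsII] (2.51)–(2.52) p. 232,
# (2.67) p. 234: THE CLASS-LOCALISED SITE INPUT NORM `bHS` AGAINST THE FIBRE BLOCKS `ofBlocks (blkSK sI)` — the site twins of `B9CoReadingCoordsInputLoc` — and the
# COMPARISON OF `bHS ε` ACROSS EXPONENTS (`(bHS ε).loc ≤ 3·(bHS ε′).loc` for `0 < ε ≤ ε′`)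

statement-level skeleton of published theorems with citation tags; proofs where landed; nothing here is a claim about the Yang–Mills mass gap

WHY THIS FILE (cell `pub-ymgap`, node N06 [B9], FLAG №8 (U8) STEP 2b; seat dag-n06-d g18).  The producer `G₀D_U : bHW ε → 𝔖₁` of the row-21 S-leaf's `hstate1`
(dag-n06-l `thm313Printed_completePairMBCZcUS`) lands an operator INTO the (P1′) pin class out of the SITE input norm `bHW ε := B9CoReadingCoordsInputS.bHS i (sIK bI) ε`
(dag-n06-d g6; the certificate's rows-18 site input family) via n06-l's `B9HolderProbesKAFromGradSrc.hasMaj_into_bHZKPG_of_sup_grad` — whose sup member must be read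
OUT OF `bHS ε`.  Print's (3.42)₃ sup word is read out of the sharp FIBRE sup class `ofBlocks (blkSK (sIK bI))`; `bHS` is CLASS-localised.  The transfer
`B9BlockNormClassTransfer.hasMaj_of_dom_classes` needs (v) fibre pieces of a class-localised function vanish outside the class and (d) each fibre piece is below the
input norm — §1 here (the bond twins are `B9CoReadingCoordsInputLoc`).  §2: the leaf asks the producer for EVERY `ε > 0` while print's (3.44) gradient word comes at
`ε ≤ 1`; the site pair weight `wS ε = ((|z′ − z|_T·η)^ε)⁻¹` is not monotone in `ε` (pairs farther than `η⁻¹` apart), but a pair term with `|z′ − z|_T·η > 1` has weight `≤ 1`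
and difference `≤ 2·supS`, so `holS ε ≤ holS ε′ + 2·supS` and `(bHS ε).loc ≤ 3·(bHS ε′).loc` for `0 < ε ≤ ε′` (★ `bHS_loc_le_three_mul`), whence every member OUT OF
`bHS ε′` is a member out of `bHS ε` with thrice the majorant (★ `hasMaj_bHS_of_le`).
## WHAT IS PROVED (sorry-free, standard axioms)
* ★ `cut_ofBlocks_eq_zero_of_isLoc_bHS`, ★ `loc_ofBlocks_cut_le_loc_bHS`, `vanishW_bHS_pins`, `leW_bHS_pins` (§1);
* `abs_restrS_le_supS`, ★ `holS_le_holS_add`, ★ `bHS_loc_le_three_mul`, ★ `hasMaj_bHS_of_le` (§2).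
HONEST FRAMING.  Finite bookkeeping about two block norms; nothing of [B9] asserted; COUNT-NEUTRAL; N06 NOT discharged; nothing continuum ∕ OS ∕ mass-gap ∕ Clay.
Cell `pub-ymgap` (D-0062), node N06 [B9], 2026-08-29.  A NEW file; nothing landed is modified.
-/

namespace Literature.MathematicalPhysics.QuantumFieldTheory.Balaban1983to89.B9CoReadingCoordsInputSLoc

open B4TorusKernel.MultiPeriod (torusSupNorm torusSupNorm_nonneg)
open B6KLevelCensusIndexV1 (KIdx)
open B6MultiLevelTorusOperator (one_le_N0)
open B6Prop22KLevelTorusCensusEta (nKT nKT_pos)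
open B9GeoNormsKLevelV1 (geo9K)
open B9Thm34Ext (toB6)
open B11SectG (BlockNorm HasMaj)
open B6RandomWalk (blockPiece)
open B9CoReadingCoordsS (XSK blkSK)
open B9CoRealizesRelAtLetters (RelB)
open B9CoReadingCoordsHolderS (wS wS_nonneg)
open B9CoReadingCoordsInputS (bHS supS holS restrS supS_nonneg holS_nonneg)
open Node00 (SiteY IBondY toKT)

noncomputable section

variable {d ℓ : ℕ} {hd : 1 ≤ d + 1} {hL : Odd (ℓ + 1) ∧ 1 < ℓ + 1} {b₀ b₁ : ℝ}
variable {κ : Type} [Fintype κ]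
variable (i : KIdx d ℓ hd hL b₀ b₁) [Fintype (geo9K i).Site] [DecidableRel (RelB i)] (sI : SiteY i → IBondY i) {R : ℝ} {H : Prop}

/-! ## §1 The class-localised site input norm against the fibre blocks -/

/-- ★ **(v) THE FIBRE PIECES OF A CLASS-LOCALISED SITE FUNCTION VANISH OUTSIDE THE CLASS**: if `μ` vanishes off the carrier class of `y′` (`bHS`-localised) and `y″` is
not in that class, the `y″`-fibre piece of `μ` is zero. [cite: Balaban1985BackgroundPropagators, (3.44) p.398 («supp λ ⊂ Δ(y′)»); Balaban1984PropagatorsII, (2.45) p.231, bookkeeping] -/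
theorem cut_ofBlocks_eq_zero_of_isLoc_bHS (ε : ℝ) {y' y'' : IBondY i} {μ : XSK κ i → ℝ}
    (hμ : (bHS i sI ε (R := R) (H := H)).IsLoc y' μ) (hy : ¬ RelB i y'' y') :
    (BlockNorm.ofBlocks (toB6 (geo9K i) R H) (blkSK i sI)).cut y'' μ = 0 := by
  have hpt : ∀ p : XSK κ i, blockPiece (g := toB6 (geo9K i) R H) (blkSK i sI) y'' μ p = 0 := fun p => by
    unfold blockPiece
    split_ifs with h
    · have h' : sI p.1 = y'' := h
      exact hμ p (fun hr => hy (h' ▸ hr))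
    · rfl
  exact funext hpt

/-- ★ **(d) A FIBRE PIECE INSIDE THE CLASS IS BOUNDED BY THE SITE INPUT NORM**: for `y″` in the carrier class of `y′`, the fibre sup of the `y″`-piece of `μ` is at
most `supS y′ μ ≤ supS y′ μ + holS ε y′ μ = (bHS i sI ε).loc y′ μ`. [cite: Balaban1985BackgroundPropagators, (3.39)–(3.41) p.397, (3.44) p.398; Balaban1984PropagatorsII, (2.51)–(2.52) p.232, bookkeeping] -/
theorem loc_ofBlocks_cut_le_loc_bHS (ε : ℝ) {y' y'' : IBondY i} (μ : XSK κ i → ℝ) (hy : RelB i y'' y') :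
    (BlockNorm.ofBlocks (toB6 (geo9K i) R H) (blkSK i sI)).loc y'' ((BlockNorm.ofBlocks (toB6 (geo9K i) R H) (blkSK i sI)).cut y'' μ) ≤
      (bHS i sI ε (R := R) (H := H)).loc y' μ := by
  classical
  refine le_trans ?_ (le_add_of_nonneg_right (holS_nonneg i sI ε y' μ))
  change (⨆ p : XSK κ i, _) ≤ supS i sI y' μ
  refine Real.iSup_le (fun p => ?_) (supS_nonneg i sI y' μ)
  split_ifs with h
  · have h' : sI p.1 = y'' := h
    have hrel : RelB i (sI p.1) y' := h' ▸ hy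
    have hp : ((BlockNorm.ofBlocks (toB6 (geo9K i) R H) (blkSK i sI)).cut y'' μ) p = restrS i sI y' μ p := by
      show blockPiece (g := toB6 (geo9K i) R H) (blkSK i sI) y'' μ p = restrS i sI y' μ p
      unfold blockPiece restrS
      rw [if_pos hrel]
      split_ifs; rfl
    rw [hp]
    exact le_ciSup (Finite.bddAbove_range fun p : XSK κ i => |restrS i sI y' μ p|) p
  · exact supS_nonneg i sI y' μ

/-- (v) in the `ε`-indexed binder shape (`hvanish` of `B9BlockNormClassTransfer.hasMaj_of_dom_classes`) at the site pins `bHW := fun ε => bHS i sI ε`, `blkW := blkSK i sI`.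
[cite: Balaban1985BackgroundPropagators, (3.44) p.398, bookkeeping] -/
theorem vanishW_bHS_pins : ∀ ε : ℝ, 0 < ε → ∀ (y' : IBondY i) (μ : XSK κ i → ℝ), (bHS i sI ε (R := R) (H := H)).IsLoc y' μ →
    ∀ y'' : IBondY i, ¬ RelB i y'' y' → (BlockNorm.ofBlocks (toB6 (geo9K i) R H) (blkSK i sI)).cut y'' μ = 0 :=
  fun ε _ _ _ hμ _ hy => cut_ofBlocks_eq_zero_of_isLoc_bHS i sI ε hμ hy

/-- (d) in the `ε`-indexed binder shape (`hle` of the class transfer) at the same pins. [cite: Balaban1985BackgroundPropagators, (3.44) p.398, bookkeeping] -/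
theorem leW_bHS_pins : ∀ ε : ℝ, 0 < ε → ∀ (y' : IBondY i) (μ : XSK κ i → ℝ), (bHS i sI ε (R := R) (H := H)).IsLoc y' μ →
    ∀ y'' : IBondY i, RelB i y'' y' →
      (BlockNorm.ofBlocks (toB6 (geo9K i) R H) (blkSK i sI)).loc y'' ((BlockNorm.ofBlocks (toB6 (geo9K i) R H) (blkSK i sI)).cut y'' μ) ≤
        (bHS i sI ε (R := R) (H := H)).loc y' μ :=
  fun ε _ _ μ _ _ hy => loc_ofBlocks_cut_le_loc_bHS i sI ε μ hy

/-! ## §2 The site input norm across exponents -/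

omit [Fintype (geo9K i).Site] [DecidableRel (RelB i)] in
/-- every restricted value is below the class-restricted sup. [cite: Balaban1985BackgroundPropagators, (3.39) p.397, bookkeeping] -/
theorem abs_restrS_le_supS [DecidableRel (RelB i)] (y : IBondY i) (F : XSK κ i → ℝ) (p : XSK κ i) : |restrS i sI y F p| ≤ supS i sI y F :=
  le_ciSup (Finite.bddAbove_range fun p : XSK κ i => |restrS i sI y F p|) p

omit [Fintype (geo9K i).Site] in
/-- ★ **THE HÖLDER PART ACROSS EXPONENTS**: `holS ε y F ≤ holS ε′ y F + 2·supS y F` for `0 < ε ≤ ε′` — a pair with `|z′ − z|_T·η ≤ 1` has `wS ε ≤ wS ε′`; a pair with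
`|z′ − z|_T·η > 1` has `wS ε ≤ 1` and restricted difference `≤ 2·supS`. [cite: Balaban1985BackgroundPropagators, (3.40) p.397 (bookkeeping); Balaban1984PropagatorsII, (2.67) p.234] -/
theorem holS_le_holS_add {ε ε' : ℝ} (hε : 0 < ε) (hεε' : ε ≤ ε') (y : IBondY i) (F : XSK κ i → ℝ) :
    holS i sI ε y F ≤ holS i sI ε' y F + 2 * supS i sI y F := by
  classical
  have hS0 : 0 ≤ supS i sI y F := supS_nonneg i sI y F
  have hH0 : 0 ≤ holS i sI ε' y F := holS_nonneg i sI ε' y F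
  unfold holS
  refine Real.iSup_le (fun q => ?_) (by positivity)
  by_cases h : q.1.1 ≠ q.1.2 ∧ RelB i (sI q.1.1) y
  · rw [if_pos h]
    set r : ℝ := torusSupNorm (toKT i).NB (q.1.2.1 - q.1.1.1) / (nKT (toKT i)) with hr
    have hr0 : 0 ≤ r := div_nonneg (torusSupNorm_nonneg (fun μ => one_le_N0 (toKT i).hMh (toKT i).hP μ) _) (Nat.cast_nonneg _)
    have hw : wS i ε q.1.1 q.1.2 = (r ^ ε)⁻¹ := rfl
    have hw' : wS i ε' q.1.1 q.1.2 = (r ^ ε')⁻¹ := rfl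
    have hD : |restrS i sI y F (q.1.2, q.2) - restrS i sI y F (q.1.1, q.2)| ≤ 2 * supS i sI y F :=
      (abs_sub _ _).trans (by linarith [abs_restrS_le_supS i sI y F (q.1.2, q.2), abs_restrS_le_supS i sI y F (q.1.1, q.2)])
    have hD0 : 0 ≤ |restrS i sI y F (q.1.2, q.2) - restrS i sI y F (q.1.1, q.2)| := abs_nonneg _
    by_cases hr1 : r ≤ 1
    · -- near pair: the weight grows with the exponent
      have hterm : wS i ε' q.1.1 q.1.2 * |restrS i sI y F (q.1.2, q.2) - restrS i sI y F (q.1.1, q.2)| ≤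
          ⨆ q : (SiteY i × SiteY i) × Fin (d + 1) × κ × κ,
            (if q.1.1 ≠ q.1.2 ∧ RelB i (sI q.1.1) y then wS i ε' q.1.1 q.1.2 * |restrS i sI y F (q.1.2, q.2) - restrS i sI y F (q.1.1, q.2)| else 0) := by
        have h1 := le_ciSup (Finite.bddAbove_range fun q : (SiteY i × SiteY i) × Fin (d + 1) × κ × κ =>
          (if q.1.1 ≠ q.1.2 ∧ RelB i (sI q.1.1) y then wS i ε' q.1.1 q.1.2 * |restrS i sI y F (q.1.2, q.2) - restrS i sI y F (q.1.1, q.2)| else 0)) q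
        simp only [if_pos h] at h1
        exact h1
      have hwle : wS i ε q.1.1 q.1.2 ≤ wS i ε' q.1.1 q.1.2 := by
        rw [hw, hw']
        rcases hr0.eq_or_lt with h0 | hpos
        · rw [← h0, Real.zero_rpow hε.ne', Real.zero_rpow (hε.trans_le hεε').ne']
        · exact inv_anti₀ (Real.rpow_pos_of_pos hpos _) (Real.rpow_le_rpow_of_exponent_ge hpos hr1 hεε')
      calc wS i ε q.1.1 q.1.2 * |restrS i sI y F (q.1.2, q.2) - restrS i sI y F (q.1.1, q.2)|
          ≤ wS i ε' q.1.1 q.1.2 * |restrS i sI y F (q.1.2, q.2) - restrS i sI y F (q.1.1, q.2)| := mul_le_mul_of_nonneg_right hwle hD0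
        _ ≤ _ := hterm
        _ ≤ _ := le_add_of_nonneg_right (by positivity)
    · -- far pair: weight at most one, difference at most `2·supS`
      push Not at hr1
      have hwle : wS i ε q.1.1 q.1.2 ≤ 1 := by
        rw [hw]
        exact inv_le_one_of_one_le₀ (Real.one_le_rpow hr1.le hε.le)
      calc wS i ε q.1.1 q.1.2 * |restrS i sI y F (q.1.2, q.2) - restrS i sI y F (q.1.1, q.2)|
          ≤ 1 * (2 * supS i sI y F) := mul_le_mul hwle hD hD0 zero_le_one
        _ ≤ _ := by rw [one_mul]; exact le_add_of_nonneg_left hH0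
  · rw [if_neg h]; positivity

/-- ★ **THE SITE INPUT NORM ACROSS EXPONENTS**: `(bHS ε).loc y F ≤ 3·(bHS ε′).loc y F` for `0 < ε ≤ ε′`; the localisation does not depend on `ε`.
[cite: Balaban1985BackgroundPropagators, (3.39)–(3.41) p.397 + (3.44) p.398 (bookkeeping); Balaban1984PropagatorsII, (2.67) p.234] -/
theorem bHS_loc_le_three_mul {ε ε' : ℝ} (hε : 0 < ε) (hεε' : ε ≤ ε') (y : IBondY i) (F : XSK κ i → ℝ) :
    (bHS i sI ε (R := R) (H := H)).loc y F ≤ 3 * (bHS i sI ε' (R := R) (H := H)).loc y F := by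
  have hS0 : 0 ≤ supS i sI y F := supS_nonneg i sI y F
  have h := holS_le_holS_add i sI hε hεε' y F
  show supS i sI y F + holS i sI ε y F ≤ 3 * (supS i sI y F + holS i sI ε' y F)
  have hH0 : 0 ≤ holS i sI ε' y F := holS_nonneg i sI ε' y F
  linarith

/-- ★ **A MEMBER OUT OF `bHS ε` IS A MEMBER OUT OF `bHS ε′` FOR `0 < ε ≤ ε′`** with thrice the (non-negative) majorant (`(bHS ε).loc ≤ 3·(bHS ε′).loc`; the localisation
is the same) — how the certificate supplies the S-leaf's `∀ ε > 0` producer `G₀D_U : bHW ε → 𝔖₁` from print's words at `min ε 1`.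
[cite: Balaban1985BackgroundPropagators, (3.44) p.398 (bookkeeping); Balaban1984PropagatorsII, (2.51)–(2.52) p.232] -/
theorem hasMaj_bHS_of_le {F₂ : Type} [AddCommGroup F₂] [Module ℝ F₂] {b₂ : BlockNorm (toB6 (geo9K i) R H) F₂} {T : (XSK κ i → ℝ) →ₗ[ℝ] F₂}
    {K : IBondY i → IBondY i → ℝ} (hK : ∀ a c, 0 ≤ K a c) {ε ε' : ℝ} (hε : 0 < ε) (hεε' : ε ≤ ε')
    (h : HasMaj (bHS i sI ε (R := R) (H := H)) b₂ T K) :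
    HasMaj (bHS i sI ε' (R := R) (H := H)) b₂ T (fun a c => 3 * K a c) := fun y' μ hμ y =>
  calc b₂.loc y (T μ) ≤ K y y' * (bHS i sI ε (R := R) (H := H)).loc y' μ := h y' μ hμ y
    _ ≤ K y y' * (3 * (bHS i sI ε' (R := R) (H := H)).loc y' μ) :=
        mul_le_mul_of_nonneg_left (bHS_loc_le_three_mul i sI hε hεε' y' μ) (hK y y')
    _ = 3 * K y y' * (bHS i sI ε' (R := R) (H := H)).loc y' μ := by ring

end

end Literature.MathematicalPhysics.QuantumFieldTheory.Balaban1983to89.B9CoReadingCoordsInputSLoc
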